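import Summits.HubbardSuperconductivity.HubbardSuperconductivity.Theses.ParityGapRigidity
import Literature.MathematicalPhysics.QuantumLattice.LatticeToriProofs
import Literature.MathematicalPhysics.QuantumLattice.HubbardHubbardModelProofs
import HarnessLib

/-!
# Stub `stub_varianceOfClustering` of line `registered`
# (crux `GappedWindow`, item stmt-HubbardSuperconductivity-2196, route ParityGapRigidity)

**What.** The kinematic stub K of the birth skeleton of the crux
`Summit.HubbardSuperconductivity.HubbardSuperconductivity.Theses.ParityGapRigidity.GappedWindow`:
for every summable radial profile `F : ℕ → ℝ` (`F ≥ 0`, `Σ_r (2r+1) F r < ∞`) there is ONE constant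
`C'` such that on every torus side `L` and for every Fock vector `ψ` of the `2D` Hubbard orbital set
`Orb (FermionTorus 2 L)` (no normalisation, no Hamiltonian), clustering of the connected correlations
of the nearest-neighbour particle–hole bilinears `B_p = c†_{p₁} c_{p₂}`,
`|⟨B_p† B_q⟩_ψ - conj⟨B_p⟩_ψ ⟨B_q⟩_ψ| ≤ F (dist (site p₁, site q₁))` for supported `p, q`
(sites of `p₁, p₂` at torus distance `≤ 1`, likewise for `q`), implies the (H2) variance inequality
`Re⟨A† A⟩_ψ - |⟨A⟩_ψ|² ≤ C' · L²` for every `A = Σ_p a(p) B_p` with `|a| ≤ 1` supported on such pairs.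

**Why.** In the composition `GappedWindow_of` of the line, K converts the clustering profile `F`
delivered by the existence stub S into the (H2) constant of the crux, uniformly in `L` because `C'`
depends on `F` only.

**Proof sketch.**
* Algebra (`variance_eq_re_sum`): `(Σ a•B)ᴴ (Σ a•B) = Σ_{p,q} (conj a_p · a_q) • B_pᴴ B_q` and
  `expect` is linear, so `Re⟨A†A⟩ - |⟨A⟩|² = Re Σ_{p,q} conj(a_p) a_q G_{pq}` with
  `G_{pq} = ⟨B_p†B_q⟩ - conj⟨B_p⟩⟨B_q⟩`.
* Bound (`re_variance_le`): `Re z ≤ ‖z‖`, the triangle inequality, `|a| ≤ 1`, and the clustering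
  hypothesis (needed only when `a_p ≠ 0 ≠ a_q`, i.e. for supported pairs) give
  `≤ Σ_{p,q} χ(p) χ(q) F(dist(p₁, q₁))`, `χ` the indicator of supported pairs.
* Counting (`sum_prod_prod_le`, `sum_orb_indicator_le`, `sum_orb_profile_le`): each orbital has at
  most `2 · 3² = 18` partner orbitals within torus distance `1` (`card_filter_torusDist_le`), and
  `Σ_{o'} F(dist(o, o')) = 2 Σ_u F(dist(x, u)) ≤ 2 Σ_{r<L} 4(2r+1) F(r) ≤ 8 S_F`
  (`sum_radial_le`, `card_filter_torusDist_eq_le`, partial sums of a nonnegative summable series),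
  `S_F = Σ'_r (2r+1) F(r)`; summing over the `2L²` orbitals gives `C' = 2 · 18² · 8 S_F`.
* `L = 0`: the orbital set is empty and every per-orbital bound is vacuous.

**Sources.** Folklore (fluctuation bounds from summable clustering); the format of the clustering
hypothesis follows M. B. Hastings, T. Koma, *Spectral gap and exponential decay of correlations*,
Comm. Math. Phys. 265 (2006) 781, §2. Tree facts used: `expect_sum`, `expect_smul`
(`PairCorrelationsProofs`), `sum_radial_le`, `card_filter_torusDist_eq_le`, `torusDist_lt`,
`torusDist_comm'` (`LatticeToriProofs`), `card_filter_torusDist_le` (`HubbardHubbardModelProofs`),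
`FermionTorus.equivTorusSite` (`HubbardModel`).
-/

noncomputable section

namespace Summit.HubbardSuperconductivity.GappedWindow.Birth

open Literature.MathematicalPhysics.QuantumLattice Literature.Probability.LatticeModels Matrix
open Finset hiding expect
open scoped BigOperators ComplexOrder

/-! ### Algebra: the variance of a bilinear as a double sum of connected correlations -/

/-- For `A = Σ_p a p • B p`: `Re ⟨Aᴴ A⟩_ψ - ‖⟨A⟩_ψ‖² = Re Σ_p Σ_q conj (a p) · a q · G p q` with the
connected correlation `G p q = ⟨(B p)ᴴ B q⟩_ψ - conj ⟨B p⟩_ψ · ⟨B q⟩_ψ` (bilinearity of `expect` and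
`‖z‖² = conj z · z`). -/
theorem variance_eq_re_sum {ι κ : Type*} [Fintype ι] [Fintype κ] (a : κ → ℂ)
    (B : κ → Matrix (Finset ι) (Finset ι) ℂ) (ψ : Fock ι) :
    (expect ((∑ p, a p • B p)ᴴ * (∑ p, a p • B p)) ψ).re - ‖expect (∑ p, a p • B p) ψ‖ ^ 2 =
      (∑ p, ∑ q, star (a p) * a q *
        (expect ((B p)ᴴ * B q) ψ - star (expect (B p) ψ) * expect (B q) ψ)).re := by
  have hA : (∑ p, a p • B p)ᴴ = ∑ p, star (a p) • (B p)ᴴ := by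
    rw [conjTranspose_sum]
    simp only [conjTranspose_smul]
  have hAA : (∑ p, a p • B p)ᴴ * (∑ p, a p • B p) =
      ∑ p, ∑ q, (star (a p) * a q) • ((B p)ᴴ * B q) := by
    rw [hA, Finset.sum_mul]
    refine Finset.sum_congr rfl fun p _ => ?_
    rw [Finset.mul_sum]
    refine Finset.sum_congr rfl fun q _ => ?_
    rw [smul_mul_assoc, mul_smul_comm, smul_smul]
  have h1 : expect ((∑ p, a p • B p)ᴴ * (∑ p, a p • B p)) ψ =
      ∑ p, ∑ q, star (a p) * a q * expect ((B p)ᴴ * B q) ψ := by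
    rw [hAA, expect_sum]
    refine Finset.sum_congr rfl fun p _ => ?_
    rw [expect_sum]
    refine Finset.sum_congr rfl fun q _ => ?_
    rw [expect_smul]
  have h2 : expect (∑ p, a p • B p) ψ = ∑ q, a q * expect (B q) ψ := by
    rw [expect_sum]
    refine Finset.sum_congr rfl fun q _ => ?_
    rw [expect_smul]
  have h3 : ‖expect (∑ p, a p • B p) ψ‖ ^ 2 =
      (∑ p, ∑ q, star (a p) * a q * (star (expect (B p) ψ) * expect (B q) ψ)).re := by
    have key : (∑ p, ∑ q, star (a p) * a q * (star (expect (B p) ψ) * expect (B q) ψ)) =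
        star (expect (∑ p, a p • B p) ψ) * expect (∑ p, a p • B p) ψ := by
      rw [h2, star_sum, Finset.sum_mul_sum]
      refine Finset.sum_congr rfl fun p _ => Finset.sum_congr rfl fun q _ => ?_
      rw [star_mul']
      ring
    rw [key, ← starRingEnd_apply, Complex.conj_mul', ← Complex.ofReal_pow, Complex.ofReal_re]
  rw [h1, h3, ← Complex.sub_re, ← Finset.sum_sub_distrib]
  refine congrArg Complex.re (Finset.sum_congr rfl fun p _ => ?_)
  rw [← Finset.sum_sub_distrib]
  refine Finset.sum_congr rfl fun q _ => ?_
  ring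

/-- **Variance bound from termwise bounds.** If `|a| ≤ 1` and the connected correlation of
`(B p, B q)` is bounded by `w p q ≥ 0` whenever `a p ≠ 0 ≠ a q`, then
`Re ⟨Aᴴ A⟩_ψ - ‖⟨A⟩_ψ‖² ≤ Σ_p Σ_q w p q` for `A = Σ_p a p • B p`
(`variance_eq_re_sum`, `Re z ≤ ‖z‖`, triangle inequality). -/
theorem re_variance_le {ι κ : Type*} [Fintype ι] [Fintype κ] (a : κ → ℂ)
    (B : κ → Matrix (Finset ι) (Finset ι) ℂ) (ψ : Fock ι) (w : κ → κ → ℝ)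
    (hw : ∀ p q, a p ≠ 0 → a q ≠ 0 →
      ‖expect ((B p)ᴴ * B q) ψ - star (expect (B p) ψ) * expect (B q) ψ‖ ≤ w p q)
    (hw0 : ∀ p q, 0 ≤ w p q) (ha : ∀ p, ‖a p‖ ≤ 1) :
    (expect ((∑ p, a p • B p)ᴴ * (∑ p, a p • B p)) ψ).re - ‖expect (∑ p, a p • B p) ψ‖ ^ 2 ≤
      ∑ p, ∑ q, w p q := by
  rw [variance_eq_re_sum]
  refine (Complex.re_le_norm _).trans ((norm_sum_le _ _).trans ?_)
  refine Finset.sum_le_sum fun p _ => (norm_sum_le _ _).trans (Finset.sum_le_sum fun q _ => ?_)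
  by_cases hp : a p = 0
  · simp [hp, hw0]
  by_cases hq : a q = 0
  · simp [hq, hw0]
  rw [norm_mul, norm_mul, norm_star]
  calc ‖a p‖ * ‖a q‖ * ‖expect ((B p)ᴴ * B q) ψ - star (expect (B p) ψ) * expect (B q) ψ‖
      ≤ 1 * 1 * w p q :=
        mul_le_mul (mul_le_mul (ha p) (ha q) (norm_nonneg _) zero_le_one) (hw p q hp hq)
          (norm_nonneg _) (by norm_num)
    _ = w p q := by ring

/-! ### Counting: an abstract double-sum bound -/

/-- **Abstract counting.** For nonnegative kernels `χ, f` on a finite type with row sums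
`Σ_{o'} χ o o' ≤ N` and `Σ_{o'} f o o' ≤ R`, the quadruple sum
`Σ_{(o₁,o₂)} Σ_{(o₃,o₄)} χ o₁ o₂ · χ o₃ o₄ · f o₁ o₃` is at most `|α| · N² · R`
(sum out `o₄`, then `o₃`, then `o₂`). -/
theorem sum_prod_prod_le {α : Type*} [Fintype α] (χ f : α → α → ℝ) (N R : ℝ)
    (hχ : ∀ o o', 0 ≤ χ o o') (hf : ∀ o o', 0 ≤ f o o') (hN : 0 ≤ N) (hR0 : 0 ≤ R)
    (hn : ∀ o, ∑ o', χ o o' ≤ N) (hR : ∀ o, ∑ o', f o o' ≤ R) :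
    ∑ p : α × α, ∑ q : α × α, χ p.1 p.2 * χ q.1 q.2 * f p.1 q.1 ≤
      Fintype.card α * (N * N * R) := by
  simp only [Fintype.sum_prod_type]
  calc ∑ o₁, ∑ o₂, ∑ o₃, ∑ o₄, χ o₁ o₂ * χ o₃ o₄ * f o₁ o₃
      ≤ ∑ o₁, ∑ o₂, ∑ o₃, χ o₁ o₂ * f o₁ o₃ * N := by
        gcongr with o₁ _ o₂ _ o₃ _
        calc ∑ o₄, χ o₁ o₂ * χ o₃ o₄ * f o₁ o₃ = χ o₁ o₂ * f o₁ o₃ * ∑ o₄, χ o₃ o₄ := by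
              rw [Finset.mul_sum]
              exact Finset.sum_congr rfl fun _ _ => by ring
          _ ≤ χ o₁ o₂ * f o₁ o₃ * N :=
              mul_le_mul_of_nonneg_left (hn o₃) (mul_nonneg (hχ _ _) (hf _ _))
    _ ≤ ∑ o₁, ∑ o₂, χ o₁ o₂ * N * R := by
        gcongr with o₁ _ o₂ _
        calc ∑ o₃, χ o₁ o₂ * f o₁ o₃ * N = χ o₁ o₂ * N * ∑ o₃, f o₁ o₃ := by
              rw [Finset.mul_sum]
              exact Finset.sum_congr rfl fun _ _ => by ring
          _ ≤ χ o₁ o₂ * N * R := mul_le_mul_of_nonneg_left (hR o₁) (mul_nonneg (hχ _ _) hN)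
    _ ≤ ∑ _o₁ : α, N * N * R := by
        gcongr with o₁ _
        calc ∑ o₂, χ o₁ o₂ * N * R = (∑ o₂, χ o₁ o₂) * (N * R) := by
              rw [Finset.sum_mul]
              exact Finset.sum_congr rfl fun _ _ => by ring
          _ ≤ N * (N * R) := mul_le_mul_of_nonneg_right (hn o₁) (mul_nonneg hN hR0)
          _ = N * N * R := by ring
    _ = Fintype.card α * (N * N * R) := by
        rw [Finset.sum_const, nsmul_eq_mul, Finset.card_univ]

/-! ### Geometry of the orbital set `Orb (FermionTorus 2 L)` -/

/-- The Hubbard orbital set of the torus of side `L` has `2 L²` elements. -/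
theorem card_orb (L : ℕ) : Fintype.card (Orb (FermionTorus 2 L)) = L ^ 2 * 2 := by
  simp [Fintype.card_lex, Fintype.card_prod, Fintype.card_fin]

/-- A sum over orbitals is a sum over sites and spins. -/
theorem sum_orb_eq {Λ : Type*} [Fintype Λ] (g : Orb Λ → ℝ) :
    ∑ o, g o = ∑ y : Λ, ∑ σ : Fin 2, g (toLex (y, σ)) := by
  rw [← Equiv.sum_comp (toLex : Λ × Fin 2 ≃ Orb Λ) g, Fintype.sum_prod_type]

/-- A sum over the fermionic torus of a function of the comparison site is a sum over the
statistical-mechanics torus `TorusSite 2 L` (transport along `FermionTorus.equivTorusSite`). -/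
theorem sum_fermionTorus_eq {L : ℕ} [NeZero L] (h : TorusSite 2 L → ℝ) :
    ∑ y : FermionTorus 2 L, h y.toTorusSite = ∑ u : TorusSite 2 L, h u :=
  Equiv.sum_comp FermionTorus.equivTorusSite h

/-- Ball counting on `(ℤ/Lℤ)²`: at most `9` sites within torus distance `1` of any site
(`card_filter_torusDist_le`). -/
theorem sum_site_indicator_le {L : ℕ} [NeZero L] (x : TorusSite 2 L) :
    ∑ u : TorusSite 2 L, (if torusDist x u ≤ 1 then (1 : ℝ) else 0) ≤ 9 := by
  rw [Finset.sum_boole]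
  exact_mod_cast card_filter_torusDist_le L x 1

/-- Radial summation on `(ℤ/Lℤ)²`: for a nonnegative profile `F` with `Σ_r (2r+1) F r` summable,
`Σ_u F (dist (x, u)) ≤ Σ_{r<L} 4 (2r+1) F r ≤ 4 Σ'_r (2r+1) F r`
(`sum_radial_le` with the sphere count `card_filter_torusDist_eq_le`). -/
theorem sum_site_profile_le {L : ℕ} [NeZero L] (F : ℕ → ℝ) (hF : ∀ r, 0 ≤ F r)
    (hS : Summable fun r : ℕ => (2 * (r : ℝ) + 1) * F r) (x : TorusSite 2 L) :
    ∑ u : TorusSite 2 L, F (torusDist x u) ≤ 4 * ∑' r : ℕ, (2 * (r : ℝ) + 1) * F r := by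
  have h1 : ∑ u : TorusSite 2 L, F (torusDist x u) = ∑ u, F (torusDist u x) :=
    Finset.sum_congr rfl fun u _ => by rw [torusDist_comm']
  rw [h1]
  calc _ ≤ ∑ r ∈ range L, ((2 * (2 * (2 * r + 1) ^ (2 - 1))) : ℕ) * F r :=
        sum_radial_le F hF x (card_filter_torusDist_eq_le (by norm_num) x) (fun u => torusDist_lt u x)
    _ = 4 * ∑ r ∈ range L, (2 * (r : ℝ) + 1) * F r := by
        rw [Finset.mul_sum]
        refine Finset.sum_congr rfl fun r _ => ?_
        push_cast
        ring
    _ ≤ 4 * ∑' r : ℕ, (2 * (r : ℝ) + 1) * F r := by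
        gcongr
        exact hS.sum_le_tsum _ (fun r _ => mul_nonneg (by positivity) (hF r))

/-- A sum over orbitals of a function of the orbital's site is twice the corresponding sum over
the site torus `TorusSite 2 L` (two spins per site; `sum_orb_eq`, `sum_fermionTorus_eq`). -/
theorem sum_orb_site_eq {L : ℕ} [NeZero L] (g : TorusSite 2 L → ℝ) :
    ∑ o' : Orb (FermionTorus 2 L), g (ofLex o').1.toTorusSite = 2 * ∑ u : TorusSite 2 L, g u := by
  rw [sum_orb_eq]
  simp only [ofLex_toLex, Finset.sum_const, Finset.card_univ, Fintype.card_fin, nsmul_eq_mul,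
    Nat.cast_ofNat]
  rw [← Finset.mul_sum, sum_fermionTorus_eq g]

/-- Each orbital has at most `18 = 2 · 9` partner orbitals whose sites are within torus distance
`1` (two spins per site, `sum_site_indicator_le`). -/
theorem sum_orb_indicator_le {L : ℕ} [NeZero L] (o : Orb (FermionTorus 2 L)) :
    ∑ o' : Orb (FermionTorus 2 L),
      (if torusDist (ofLex o).1.toTorusSite (ofLex o').1.toTorusSite ≤ 1 then (1 : ℝ) else 0) ≤
      18 :=
  calc _ = 2 * ∑ u : TorusSite 2 L, (if torusDist (ofLex o).1.toTorusSite u ≤ 1 then (1 : ℝ) else 0) :=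
        sum_orb_site_eq fun u => if torusDist (ofLex o).1.toTorusSite u ≤ 1 then (1 : ℝ) else 0
    _ ≤ 2 * 9 := by
        gcongr
        exact sum_site_indicator_le (ofLex o).1.toTorusSite
    _ = 18 := by norm_num

/-- The radial profile summed over all orbitals: `Σ_{o'} F (dist (site o, site o')) ≤ 8 S`
whenever `Σ_u F (dist (x, u)) ≤ 4 S` on the site torus (two spins per site). -/
theorem sum_orb_profile_le {L : ℕ} [NeZero L] (F : ℕ → ℝ) (S : ℝ)
    (hrad : ∀ x : TorusSite 2 L, ∑ u : TorusSite 2 L, F (torusDist x u) ≤ 4 * S)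
    (o : Orb (FermionTorus 2 L)) :
    ∑ o' : Orb (FermionTorus 2 L),
      F (torusDist (ofLex o).1.toTorusSite (ofLex o').1.toTorusSite) ≤ 8 * S :=
  calc _ = 2 * ∑ u : TorusSite 2 L, F (torusDist (ofLex o).1.toTorusSite u) :=
        sum_orb_site_eq fun u => F (torusDist (ofLex o).1.toTorusSite u)
    _ ≤ 2 * (4 * S) := by
        gcongr
        exact hrad (ofLex o).1.toTorusSite
    _ = 8 * S := by ring

/-! ### The stub -/

/-- **Stub K `stub_varianceOfClustering`** (variance from clustering — kinematic, Hamiltonian-free):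
for every summable radial profile `F` there is one constant `C'` (here `C' = 2 · 18² · 8 S_F`,
`S_F = Σ'_r (2r+1) F r`) such that on every torus side `L` and for every Fock vector `ψ`,
clustering of the nearest-neighbour particle–hole bilinear connected correlations with profile
`F` gives `Re ⟨Aᴴ A⟩_ψ - ‖⟨A⟩_ψ‖² ≤ C' · L²` for every bilinear `A = Σ_p a p • c†_{p₁} c_{p₂}`
with `|a| ≤ 1` supported on orbital pairs whose sites are at torus distance `≤ 1`.
Proof: `re_variance_le` with the weight `χ(p) χ(q) F(dist(p₁, q₁))`, then `sum_prod_prod_le`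
with the per-orbital bounds `sum_orb_indicator_le` (`N = 18`) and `sum_orb_profile_le`
(`R = 8 S_F`), and `|Orb| = 2 L²` (`card_orb`); for `L = 0` the orbital set is empty. -/
theorem stub_varianceOfClustering :
    ∀ F : ℕ → ℝ, ((∀ r, 0 ≤ F r) ∧ Summable fun r : ℕ => (2 * (r : ℝ) + 1) * F r) →
      ∃ C' : ℝ, ∀ (L : ℕ) (ψ : Fock (Orb (FermionTorus 2 L))),
        (∀ p q : Orb (FermionTorus 2 L) × Orb (FermionTorus 2 L),
              torusDist (ofLex p.1).1.toTorusSite (ofLex p.2).1.toTorusSite ≤ 1 →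
              torusDist (ofLex q.1).1.toTorusSite (ofLex q.2).1.toTorusSite ≤ 1 →
                ‖expect (Matrix.conjTranspose (creation p.1 * annihilation p.2) * (creation q.1 * annihilation q.2)) ψ -
                    star (expect (creation p.1 * annihilation p.2) ψ) * expect (creation q.1 * annihilation q.2) ψ‖ ≤
                  F (torusDist (ofLex p.1).1.toTorusSite (ofLex q.1).1.toTorusSite)) →
        ∀ a : Orb (FermionTorus 2 L) × Orb (FermionTorus 2 L) → ℂ, (∀ p, ‖a p‖ ≤ 1) →
          (∀ p, a p ≠ 0 → torusDist (ofLex p.1).1.toTorusSite (ofLex p.2).1.toTorusSite ≤ 1) →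
            (expect (Matrix.conjTranspose (∑ p, a p • (creation p.1 * annihilation p.2)) *
                (∑ p, a p • (creation p.1 * annihilation p.2))) ψ).re -
              ‖expect (∑ p, a p • (creation p.1 * annihilation p.2)) ψ‖ ^ 2 ≤ C' * (L : ℝ) ^ 2 := by
  rintro F ⟨hF, hS⟩
  -- the radial constant `S = Σ'_r (2r+1) F r`
  set S : ℝ := ∑' r : ℕ, (2 * (r : ℝ) + 1) * F r
  have hS0 : 0 ≤ S := tsum_nonneg fun r => mul_nonneg (by positivity) (hF r)
  refine ⟨2 * (18 * 18 * (8 * S)), fun L ψ hcl a ha hsupp => ?_⟩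
  -- the indicator of supported pairs and the profile kernel, as functions of two orbitals
  let χ : Orb (FermionTorus 2 L) → Orb (FermionTorus 2 L) → ℝ := fun o o' =>
    if torusDist (ofLex o).1.toTorusSite (ofLex o').1.toTorusSite ≤ 1 then 1 else 0
  let f : Orb (FermionTorus 2 L) → Orb (FermionTorus 2 L) → ℝ := fun o o' =>
    F (torusDist (ofLex o).1.toTorusSite (ofLex o').1.toTorusSite)
  have hχ0 : ∀ o o', 0 ≤ χ o o' := fun o o' => by
    simp only [χ]
    split_ifs <;> norm_num
  have hf0 : ∀ o o', 0 ≤ f o o' := fun o o' => hF _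
  -- Step 1–2: algebra and termwise bound
  have hmain : (expect (Matrix.conjTranspose (∑ p, a p • (creation p.1 * annihilation p.2)) *
        (∑ p, a p • (creation p.1 * annihilation p.2))) ψ).re -
      ‖expect (∑ p, a p • (creation p.1 * annihilation p.2)) ψ‖ ^ 2 ≤
      ∑ p : Orb (FermionTorus 2 L) × Orb (FermionTorus 2 L),
        ∑ q : Orb (FermionTorus 2 L) × Orb (FermionTorus 2 L), χ p.1 p.2 * χ q.1 q.2 * f p.1 q.1 := by
    refine re_variance_le a (fun p => creation p.1 * annihilation p.2) ψ
      (fun p q => χ p.1 p.2 * χ q.1 q.2 * f p.1 q.1) ?_ ?_ ha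
    · intro p q hp hq
      have hp' := hsupp p hp
      have hq' := hsupp q hq
      have h1 : χ p.1 p.2 = 1 := if_pos hp'
      have h2 : χ q.1 q.2 = 1 := if_pos hq'
      rw [h1, h2, one_mul, one_mul]
      exact hcl p q hp' hq'
    · intro p q
      exact mul_nonneg (mul_nonneg (hχ0 _ _) (hχ0 _ _)) (hf0 _ _)
  -- Step 3–4: per-orbital geometric bounds (vacuous for `L = 0`, where the orbital set is empty)
  have hgeo : (∀ o : Orb (FermionTorus 2 L), ∑ o', χ o o' ≤ 18) ∧
      ∀ o : Orb (FermionTorus 2 L), ∑ o', f o o' ≤ 8 * S := by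
    rcases Nat.eq_zero_or_pos L with rfl | hL
    · exact ⟨fun o => Fin.elim0 (ofLex (ofLex o).1 0), fun o => Fin.elim0 (ofLex (ofLex o).1 0)⟩
    · haveI : NeZero L := NeZero.of_pos hL
      exact ⟨fun o => sum_orb_indicator_le o,
        fun o => sum_orb_profile_le F S (fun x => sum_site_profile_le F hF hS x) o⟩
  -- assembly
  calc _ ≤ ∑ p : Orb (FermionTorus 2 L) × Orb (FermionTorus 2 L),
        ∑ q : Orb (FermionTorus 2 L) × Orb (FermionTorus 2 L), χ p.1 p.2 * χ q.1 q.2 * f p.1 q.1 :=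
        hmain
    _ ≤ Fintype.card (Orb (FermionTorus 2 L)) * (18 * 18 * (8 * S)) :=
        sum_prod_prod_le χ f 18 (8 * S) hχ0 hf0 (by norm_num) (by positivity) hgeo.1 hgeo.2
    _ = 2 * (18 * 18 * (8 * S)) * (L : ℝ) ^ 2 := by
        rw [card_orb]
        push_cast
        ring

end Summit.HubbardSuperconductivity.GappedWindow.Birth
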